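import Literature.Analysis.Calculus.SecondDifferenceBound
import HarnessLib

/-!
# Second derivatives of an asymptotically affine-in-`N` family of convex functions

A lemma of real analysis behind «variance = second derivative of the free energy» statements for sequences of log-partition functions
`F_N(t) = log Z_N(t)` (log-Laplace transforms of bounded random variables): if
* `F_N = N·φ + G + r_N` on a fixed interval around `0`, with `φ, G` twice differentiable, `φ''` continuous at `0`, `G''` bounded, and
  `sup |r_N| = ε_N` with `N·ε_N → 0`;
* `F_N'' ≥ 0` does not oscillate on the scale `1/N`: `e^{−KNt} F_N''(0) ≤ F_N''(t) ≤ e^{KNt} F_N''(0)` for `0 ≤ t < τ` (for a log-Laplace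
  transform of a variable with values in `[0, N]` this follows from `|F_N'''| ≤ N·F_N''` — the third cumulant is at most the range times the
  variance — by the Grönwall lemma of §2);
then `F_N''(0)/N → φ''(0)`.  (Second differences at step `η/N`: `D/h² ∈ [min F'', max F'']` by §1; `D = N D_φ + D_G + D_r` with
`|D_r| ≤ 4ε_N`; first `N → ∞`, then `η → 0`.)
* §1 the second-difference sandwich `m h² ≤ f(2h) − 2f(h) + f(0) ≤ M h²` (from the tree's `norm_second_difference_le`);
* §2 the two-sided Grönwall bound for `g ≥ 0` with `|g'| ≤ L g`;
* §3 ★★★ the limit theorem `tendsto_deriv2_div_of_quasiLinear`.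

## Sources
DemboZeitouni2010 §2.3 (Gärtner–Ellis: differentiability of the limiting log-moment generating function; lane statement of the second-order version);
BenfattoGiulianiMastropietro2006 (2.36aa) (the second-difference bound of the parent file).  Nothing quoted AS PRINTED; the arrangement is this
lineage's (lane «pcv-sawmu», a-p5 g24).
-/

noncomputable section

open Set Filter Topology

namespace Literature.Analysis

/-! ## §1 The second-difference sandwich -/

/-- **Second-difference sandwich**: if `f` has derivative `f'` and `f'` has derivative `f''` on `[x, x + 2h]` (`h ≥ 0`) with
`m ≤ f'' ≤ M` there, then `m h² ≤ f(x+2h) − 2f(x+h) + f(x) ≤ M h²` (apply `norm_second_difference_le` to `f − c t²/2`, `c = (m+M)/2`).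
[cite: BenfattoGiulianiMastropietro2006, (2.36aa) (lane corollary)] -/
theorem second_difference_mem_Icc {f f' f'' : ℝ → ℝ} {x h m M : ℝ} (hh : 0 ≤ h)
    (hf : ∀ t ∈ Icc x (x + 2 * h), HasDerivAt f (f' t) t) (hf' : ∀ t ∈ Icc x (x + 2 * h), HasDerivAt f' (f'' t) t)
    (hm : ∀ t ∈ Icc x (x + 2 * h), m ≤ f'' t) (hM : ∀ t ∈ Icc x (x + 2 * h), f'' t ≤ M) :
    m * h ^ 2 ≤ f (x + 2 * h) - 2 * f (x + h) + f x ∧ f (x + 2 * h) - 2 * f (x + h) + f x ≤ M * h ^ 2 := by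
  set c := (m + M) / 2 with hc
  set g : ℝ → ℝ := fun t => f t - c * t ^ 2 / 2 with hg
  have hg1 : ∀ t ∈ Icc x (x + 2 * h), HasDerivAt g (f' t - c * t) t := by
    intro t ht
    have h2 : HasDerivAt (fun t : ℝ => c * t ^ 2 / 2) (c * t) t := by
      have := ((hasDerivAt_pow 2 t).const_mul c).div_const 2
      simpa using this.congr_deriv (by push_cast; ring)
    exact (hf t ht).sub h2
  have hg2 : ∀ t ∈ Icc x (x + 2 * h), HasDerivAt (fun t => f' t - c * t) (f'' t - c) t := by
    intro t ht
    have h2 : HasDerivAt (fun t : ℝ => c * t) c t := by simpa using (hasDerivAt_id t).const_mul c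
    exact (hf' t ht).sub h2
  have hB : ∀ t ∈ Icc x (x + 2 * h), ‖f'' t - c‖ ≤ (M - m) / 2 := by
    intro t ht
    rw [Real.norm_eq_abs, abs_le]
    constructor
    · have := hm t ht; rw [hc]; linarith
    · have := hM t ht; rw [hc]; linarith
  have key := norm_second_difference_le (f := g) hh hg1 hg2 hB
  rw [Real.norm_eq_abs, abs_le] at key
  have e : g (x + 2 * h) - (2 : ℝ) • g (x + h) + g x = (f (x + 2 * h) - 2 * f (x + h) + f x) - c * h ^ 2 := by
    simp only [hg, smul_eq_mul]; ring
  rw [e] at key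
  obtain ⟨k1, k2⟩ := key
  constructor
  · rw [hc] at k1; nlinarith
  · rw [hc] at k2; nlinarith

/-! ## §2 Two-sided Grönwall for `|g'| ≤ L·g` -/

/-- **Two-sided Grönwall**: if `g` has derivative `g'` on an open interval containing `[0, T]` with `|g'| ≤ L·g` there, then for
`t ∈ [0, T]`: `g(t) ≤ e^{Lt} g(0)` and `g(0) ≤ e^{Lt} g(t)` (`g e^{∓Lt}` is antitone / monotone).
[cite: DemboZeitouni2010, §2.3 (lane plumbing: the variance does not oscillate on scale 1/N)] -/
theorem gronwall_two_sided_of_abs_deriv_le {g g' : ℝ → ℝ} {L T τ : ℝ} (hT : 0 ≤ T) (hτ : T < τ)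
    (hg : ∀ t ∈ Ioo (-τ) τ, HasDerivAt g (g' t) t) (hbound : ∀ t ∈ Icc 0 T, |g' t| ≤ L * g t) {t : ℝ} (ht : t ∈ Icc 0 T) :
    g t ≤ Real.exp (L * t) * g 0 ∧ g 0 ≤ Real.exp (L * t) * g t := by
  have hτ0 : 0 < τ := by linarith
  -- `u(s) = g(s) e^{−Ls}` is antitone on `[0,T]`, `v(s) = g(s) e^{Ls}` is monotone
  have hcont : ContinuousOn g (Icc 0 T) := fun s hs =>
    (hg s ⟨by linarith [hs.1], by linarith [hs.2]⟩).continuousAt.continuousWithinAt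
  have hu : AntitoneOn (fun s => g s * Real.exp (-(L * s))) (Icc 0 T) := by
    refine antitoneOn_of_deriv_nonpos (convex_Icc 0 T) ?_ ?_ ?_
    · exact hcont.mul (Continuous.continuousOn (by fun_prop))
    · intro s hs
      rw [interior_Icc] at hs
      exact ((hg s ⟨by linarith [hs.1], by linarith [hs.2]⟩).mul
        ((hasDerivAt_id s).const_mul L |>.neg.exp)).differentiableAt.differentiableWithinAt
    · intro s hs
      rw [interior_Icc] at hs
      have hd : HasDerivAt (fun s => g s * Real.exp (-(L * s))) (g' s * Real.exp (-(L * s)) + g s * (Real.exp (-(L * s)) * (-L))) s := by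
        have h1 := hg s ⟨by linarith [hs.1], by linarith [hs.2]⟩
        have h2 : HasDerivAt (fun s => Real.exp (-(L * s))) (Real.exp (-(L * s)) * (-L)) s := by
          have := ((hasDerivAt_id s).const_mul L).neg.exp
          simpa using this
        exact h1.mul h2
      rw [hd.deriv]
      have hb := hbound s ⟨hs.1.le, hs.2.le⟩
      have := (abs_le.1 hb).2
      nlinarith [Real.exp_pos (-(L * s))]
  have hv : MonotoneOn (fun s => g s * Real.exp (L * s)) (Icc 0 T) := by
    refine monotoneOn_of_deriv_nonneg (convex_Icc 0 T) ?_ ?_ ?_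
    · exact hcont.mul (Continuous.continuousOn (by fun_prop))
    · intro s hs
      rw [interior_Icc] at hs
      exact ((hg s ⟨by linarith [hs.1], by linarith [hs.2]⟩).mul
        ((hasDerivAt_id s).const_mul L |>.exp)).differentiableAt.differentiableWithinAt
    · intro s hs
      rw [interior_Icc] at hs
      have hd : HasDerivAt (fun s => g s * Real.exp (L * s)) (g' s * Real.exp (L * s) + g s * (Real.exp (L * s) * L)) s := by
        have h1 := hg s ⟨by linarith [hs.1], by linarith [hs.2]⟩
        have h2 : HasDerivAt (fun s => Real.exp (L * s)) (Real.exp (L * s) * L) s := by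
          have := ((hasDerivAt_id s).const_mul L).exp
          simpa using this
        exact h1.mul h2
      rw [hd.deriv]
      have hb := hbound s ⟨hs.1.le, hs.2.le⟩
      have := (abs_le.1 hb).1
      nlinarith [Real.exp_pos (L * s)]
  have h0 : (0 : ℝ) ∈ Icc 0 T := ⟨le_rfl, hT⟩
  have hu' := hu h0 ht ht.1
  have hv' := hv h0 ht ht.1
  simp only [mul_zero, neg_zero, Real.exp_zero, mul_one] at hu' hv'
  have hE := Real.exp_pos (L * t)
  have hEE : Real.exp (L * t) * Real.exp (-(L * t)) = 1 := by rw [← Real.exp_add]; simp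
  constructor
  · -- `g t e^{-Lt} ≤ g 0`
    calc g t = Real.exp (L * t) * (g t * Real.exp (-(L * t))) := by rw [mul_comm (g t), ← mul_assoc, hEE, one_mul]
      _ ≤ Real.exp (L * t) * g 0 := mul_le_mul_of_nonneg_left hu' hE.le
  · calc g 0 ≤ g t * Real.exp (L * t) := hv'
      _ = Real.exp (L * t) * g t := mul_comm _ _

/-! ## §3 The limit theorem -/

/-- **The one-step estimate** behind `tendsto_deriv2_div_of_quasiLinear`: with `h > 0`, `[0, 2h]` inside the interval, `E ≥ 1` controlling the
oscillation of `f″` on `[0,2h]` (`f″(0)/E ≤ f″ ≤ E f″(0)`), `|φ″ − φ″(0)| ≤ ω` and `|G″| ≤ B` on `[0,2h]`, and `|f − nφ − G| ≤ ε` at the three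
points `0, h, 2h` (`n > 0`): `(φ″(0) − ω − B/n − 4ε/(h²n))/E ≤ f″(0)/n ≤ E·(φ″(0) + ω + B/n + 4ε/(h²n))`.
[cite: DemboZeitouni2010, §2.3 (lane plumbing)] -/
theorem deriv2_div_mem_of_step {f f1 f2 φ φ1 φ2 G G1 G2 : ℝ → ℝ} {h E ω B ε n : ℝ} (hh0 : 0 < h) (hn : 0 < n) (hE1 : 1 ≤ E)
    (hf : ∀ t ∈ Icc (0 : ℝ) (0 + 2 * h), HasDerivAt f (f1 t) t) (hf1 : ∀ t ∈ Icc (0 : ℝ) (0 + 2 * h), HasDerivAt f1 (f2 t) t)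
    (hmF : ∀ t ∈ Icc (0 : ℝ) (0 + 2 * h), f2 0 / E ≤ f2 t) (hMF : ∀ t ∈ Icc (0 : ℝ) (0 + 2 * h), f2 t ≤ E * f2 0)
    (hφ : ∀ t ∈ Icc (0 : ℝ) (0 + 2 * h), HasDerivAt φ (φ1 t) t) (hφ1 : ∀ t ∈ Icc (0 : ℝ) (0 + 2 * h), HasDerivAt φ1 (φ2 t) t)
    (hmφ : ∀ t ∈ Icc (0 : ℝ) (0 + 2 * h), φ2 0 - ω ≤ φ2 t) (hMφ : ∀ t ∈ Icc (0 : ℝ) (0 + 2 * h), φ2 t ≤ φ2 0 + ω)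
    (hG : ∀ t ∈ Icc (0 : ℝ) (0 + 2 * h), HasDerivAt G (G1 t) t) (hG1 : ∀ t ∈ Icc (0 : ℝ) (0 + 2 * h), HasDerivAt G1 (G2 t) t)
    (hB : ∀ t ∈ Icc (0 : ℝ) (0 + 2 * h), |G2 t| ≤ B)
    (hr0 : |f 0 - n * φ 0 - G 0| ≤ ε) (hr1 : |f h - n * φ h - G h| ≤ ε) (hr2 : |f (2 * h) - n * φ (2 * h) - G (2 * h)| ≤ ε) :
    (φ2 0 - ω - B / n - 4 * ε / (h ^ 2 * n)) / E ≤ f2 0 / n ∧ f2 0 / n ≤ E * (φ2 0 + ω + B / n + 4 * ε / (h ^ 2 * n)) := by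
  have hE0 : 0 < E := lt_of_lt_of_le one_pos hE1
  have sF := second_difference_mem_Icc (x := 0) hh0.le hf hf1 hmF hMF
  have sφ := second_difference_mem_Icc (x := 0) hh0.le hφ hφ1 hmφ hMφ
  have sG := second_difference_mem_Icc (x := 0) (m := -B) (M := B) hh0.le hG hG1
    (fun t ht => (abs_le.1 (hB t ht)).1) (fun t ht => (abs_le.1 (hB t ht)).2)
  simp only [zero_add] at sF sφ sG
  obtain ⟨sF1, sF2⟩ := sF
  obtain ⟨sφ1, sφ2⟩ := sφ
  obtain ⟨sG1, sG2⟩ := sG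
  -- the remainder second difference
  have hDr : |(f (2 * h) - 2 * f h + f 0) - n * (φ (2 * h) - 2 * φ h + φ 0) - (G (2 * h) - 2 * G h + G 0)| ≤ 4 * ε := by
    have e1 : (f (2 * h) - 2 * f h + f 0) - n * (φ (2 * h) - 2 * φ h + φ 0) - (G (2 * h) - 2 * G h + G 0) =
        (f (2 * h) - n * φ (2 * h) - G (2 * h)) - 2 * (f h - n * φ h - G h) + (f 0 - n * φ 0 - G 0) := by ring
    rw [e1]
    have a2 := abs_le.1 hr2; have a1 := abs_le.1 hr1; have a0 := abs_le.1 hr0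
    rw [abs_le]; constructor <;> linarith only [a2.1, a2.2, a1.1, a1.2, a0.1, a0.2]
  obtain ⟨hDr1, hDr2⟩ := abs_le.1 hDr
  have hh2 : 0 < h ^ 2 := pow_pos hh0 2
  have hnh : 0 < n * h ^ 2 := mul_pos hn hh2
  -- the key algebraic identity: `(φ2 0 ∓ ω ∓ B/n ∓ 4ε/(h²n))·(n h²) = n(φ2 0 ∓ ω)h² ∓ B h² ∓ 4ε`
  have hidL : (φ2 0 - ω - B / n - 4 * ε / (h ^ 2 * n)) * (n * h ^ 2) = n * ((φ2 0 - ω) * h ^ 2) - B * h ^ 2 - 4 * ε := by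
    field_simp
  have hidU : (φ2 0 + ω + B / n + 4 * ε / (h ^ 2 * n)) * (n * h ^ 2) = n * ((φ2 0 + ω) * h ^ 2) + B * h ^ 2 + 4 * ε := by
    field_simp
  constructor
  · -- lower
    have a := mul_le_mul_of_nonneg_left sφ1 hn.le
    have h3 : n * ((φ2 0 - ω) * h ^ 2) - B * h ^ 2 - 4 * ε ≤ E * f2 0 * h ^ 2 := by linarith only [a, sG1, hDr1, sF2]
    rw [div_le_iff₀ hE0]
    have h5 : (φ2 0 - ω - B / n - 4 * ε / (h ^ 2 * n)) * (n * h ^ 2) ≤ (f2 0 / n * E) * (n * h ^ 2) := by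
      rw [hidL]
      have e : (f2 0 / n * E) * (n * h ^ 2) = E * f2 0 * h ^ 2 := by field_simp
      rw [e]; exact h3
    exact le_of_mul_le_mul_right h5 hnh
  · -- upper
    have a := mul_le_mul_of_nonneg_left sφ2 hn.le
    have h3 : f2 0 / E * h ^ 2 ≤ n * ((φ2 0 + ω) * h ^ 2) + B * h ^ 2 + 4 * ε := by linarith only [a, sG2, hDr2, sF1]
    have h3' : f2 0 * h ^ 2 ≤ E * (n * ((φ2 0 + ω) * h ^ 2) + B * h ^ 2 + 4 * ε) := by
      rw [div_mul_eq_mul_div, div_le_iff₀ hE0] at h3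
      calc f2 0 * h ^ 2 ≤ (n * ((φ2 0 + ω) * h ^ 2) + B * h ^ 2 + 4 * ε) * E := h3
        _ = _ := mul_comm _ _
    rw [div_le_iff₀ hn]
    have h5 : (f2 0) * h ^ 2 ≤ (E * (φ2 0 + ω + B / n + 4 * ε / (h ^ 2 * n)) * n) * h ^ 2 := by
      have e : (E * (φ2 0 + ω + B / n + 4 * ε / (h ^ 2 * n)) * n) * h ^ 2 =
          E * ((φ2 0 + ω + B / n + 4 * ε / (h ^ 2 * n)) * (n * h ^ 2)) := by ring
      rw [e, hidU]; exact h3'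
    exact le_of_mul_le_mul_right h5 hh2

/-- ★★★ **`F_N″(0)/N → φ″(0)` for an asymptotically affine-in-`N` family.**  Let `F_N = N·φ + G + r_N` on `(−τ, τ)` where, on that interval,
`F_N` (resp. `φ`, `G`) has first and second derivatives `F_N′, F_N″` (resp. `φ′, φ″`, `G′, G″`), `φ″` is continuous at `0`, `|G″| ≤ B`,
`|r_N| ≤ ε_N` with `N ε_N → 0`, and the second derivatives do not oscillate on the scale `1/N`:
`F_N″(t) ≤ e^{KNt} F_N″(0)` and `F_N″(0) ≤ e^{KNt} F_N″(t)` for `0 ≤ t < τ`, with `F_N″(0) ≥ 0`.  Then `F_N″(0)/N → φ″(0)`.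
For `F_N = log E e^{tX_N}` with `X_N ∈ [0, N]` the oscillation hypothesis is `gronwall_two_sided_of_abs_deriv_le` with `|F_N‴| ≤ N F_N″`, and the
conclusion reads `Var(X_N)/N → φ″(0)`: the variance density is the curvature of the limiting free energy.
[cite: DemboZeitouni2010, §2.3 (Gärtner–Ellis; lane statement of the second-order version)] -/
theorem tendsto_deriv2_div_of_quasiLinear {F F1 F2 : ℕ → ℝ → ℝ} {φ φ1 φ2 G G1 G2 : ℝ → ℝ} {τ K B : ℝ} {ε : ℕ → ℝ}
    (hτ : 0 < τ) (hK : 0 ≤ K)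
    (hF : ∀ N, ∀ t ∈ Ioo (-τ) τ, HasDerivAt (F N) (F1 N t) t) (hF1 : ∀ N, ∀ t ∈ Ioo (-τ) τ, HasDerivAt (F1 N) (F2 N t) t)
    (hF2 : ∀ N : ℕ, 0 ≤ F2 N 0)
    (hosc : ∀ N : ℕ, ∀ t ∈ Ico 0 τ, F2 N t ≤ Real.exp (K * N * t) * F2 N 0 ∧ F2 N 0 ≤ Real.exp (K * N * t) * F2 N t)
    (hφ : ∀ t ∈ Ioo (-τ) τ, HasDerivAt φ (φ1 t) t) (hφ1 : ∀ t ∈ Ioo (-τ) τ, HasDerivAt φ1 (φ2 t) t) (hφ2 : ContinuousAt φ2 0)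
    (hG : ∀ t ∈ Ioo (-τ) τ, HasDerivAt G (G1 t) t) (hG1 : ∀ t ∈ Ioo (-τ) τ, HasDerivAt G1 (G2 t) t)
    (hB : ∀ t ∈ Ioo (-τ) τ, |G2 t| ≤ B)
    (hr : ∀ N : ℕ, ∀ t ∈ Ioo (-τ) τ, |F N t - N * φ t - G t| ≤ ε N)
    (hε : Tendsto (fun N : ℕ => (N : ℝ) * ε N) atTop (𝓝 0)) :
    Tendsto (fun N : ℕ => F2 N 0 / N) atTop (𝓝 (φ2 0)) := by
  rw [Metric.tendsto_atTop]
  intro e he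
  have hB0 : 0 ≤ B := le_trans (abs_nonneg _) (hB 0 ⟨by linarith, hτ⟩)
  -- the scale `η`
  set A := |φ2 0| + 1 with hA
  have hA0 : 0 < A := by positivity
  have hφA : |φ2 0| ≤ A := by rw [hA]; linarith only [abs_nonneg (φ2 0)]
  set η := min (1 / (2 * K + 2)) (e / (16 * (K + 1) * A)) with hη
  have hη0 : 0 < η := lt_min (by positivity) (by positivity)
  have hη1 : η ≤ 1 / (2 * K + 2) := min_le_left _ _
  have hη2 : η ≤ e / (16 * (K + 1) * A) := min_le_right _ _
  have h2Kη : 2 * K * η ≤ 1 := by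
    have h1 : 2 * K * η ≤ 2 * K * (1 / (2 * K + 2)) := mul_le_mul_of_nonneg_left hη1 (by positivity)
    have h2 : 2 * K * (1 / (2 * K + 2)) ≤ 1 := by
      rw [mul_one_div, div_le_one (by positivity)]; linarith
    linarith
  have hKηA : 4 * K * η * A ≤ e / 4 := by
    have h1 : 4 * K * η * A ≤ 4 * K * (e / (16 * (K + 1) * A)) * A :=
      mul_le_mul_of_nonneg_right (mul_le_mul_of_nonneg_left hη2 (by positivity)) hA0.le
    have h2 : 4 * K * (e / (16 * (K + 1) * A)) * A = (K / (K + 1)) * (e / 4) := by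
      field_simp; ring
    have h3 : (K / (K + 1)) * (e / 4) ≤ 1 * (e / 4) :=
      mul_le_mul_of_nonneg_right ((div_le_one (by positivity)).2 (by linarith)) (by positivity)
    linarith
  -- exponential factor `E = exp(2Kη) ∈ [1, 1 + 4Kη]`
  set E := Real.exp (2 * K * η) with hE
  have hE1 : 1 ≤ E := by rw [hE]; exact Real.one_le_exp (by positivity)
  have hE0 : 0 < E := lt_of_lt_of_le one_pos hE1
  have hEup : E ≤ 1 + 4 * K * η := by
    have h := Real.abs_exp_sub_one_le (x := 2 * K * η) (by rw [abs_of_nonneg (by positivity)]; exact h2Kη)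
    rw [abs_of_nonneg (by positivity : (0:ℝ) ≤ 2 * K * η)] at h
    have := (abs_le.1 h).2
    rw [hE]; linarith
  have hE3 : E ≤ 3 := by
    have : 4 * K * η ≤ 2 := by linarith
    linarith
  clear_value A E
  -- continuity of `φ″` at `0`
  have hcont : ∀ᶠ t in 𝓝 (0 : ℝ), |φ2 t - φ2 0| < e / 16 := by
    have := Metric.tendsto_nhds.1 hφ2 (e / 16) (by positivity)
    simpa [Real.dist_eq] using this
  obtain ⟨δ, hδ0, hδ⟩ := Metric.eventually_nhds_iff.1 hcont
  -- eventual conditions in `N`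
  have ev1 : ∀ᶠ N : ℕ in atTop, (1 : ℝ) ≤ N := by
    filter_upwards [Filter.eventually_ge_atTop 1] with N hN; exact_mod_cast hN
  have ev2 : ∀ᶠ N : ℕ in atTop, 2 * η / (N : ℝ) < min δ τ := by
    have ht : Tendsto (fun N : ℕ => 2 * η / (N : ℝ)) atTop (𝓝 0) := tendsto_const_div_atTop_nhds_zero_nat _
    exact ht.eventually (gt_mem_nhds (lt_min hδ0 hτ))
  have ev3 : ∀ᶠ N : ℕ in atTop, B / (N : ℝ) ≤ e / 32 := by
    have ht : Tendsto (fun N : ℕ => B / (N : ℝ)) atTop (𝓝 0) := tendsto_const_div_atTop_nhds_zero_nat _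
    exact ht.eventually (ge_mem_nhds (by positivity))
  have ev4 : ∀ᶠ N : ℕ in atTop, 4 * ((N : ℝ) * ε N) / η ^ 2 ≤ e / 32 := by
    have ht : Tendsto (fun N : ℕ => 4 * ((N : ℝ) * ε N) / η ^ 2) atTop (𝓝 (4 * 0 / η ^ 2)) :=
      (hε.const_mul 4).div_const _
    rw [mul_zero, zero_div] at ht
    exact ht.eventually (ge_mem_nhds (by positivity))
  obtain ⟨N₀, hN₀⟩ := Filter.eventually_atTop.1 (ev1.and (ev2.and (ev3.and ev4)))
  refine ⟨N₀, fun N hN => ?_⟩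
  obtain ⟨hN1, hN2, hN3, hN4⟩ := hN₀ N hN
  have hNpos : (0 : ℝ) < N := by linarith
  -- the step `h = η/N`
  set h := η / (N : ℝ) with hh
  have hh0 : 0 < h := div_pos hη0 hNpos
  have hhN : h * N = η := by rw [hh]; field_simp
  have h2hδ : 2 * h < δ := by
    have : 2 * η / (N : ℝ) = 2 * h := by rw [hh]; ring
    linarith [lt_of_lt_of_le hN2 (min_le_left _ _)]
  have h2hτ : 2 * h < τ := by
    have : 2 * η / (N : ℝ) = 2 * h := by rw [hh]; ring
    linarith [lt_of_lt_of_le hN2 (min_le_right _ _)]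
  have hh2N : h ^ 2 * N = η ^ 2 / N := by rw [hh]; field_simp
  clear_value h
  have hIcc : ∀ t ∈ Icc (0 : ℝ) (0 + 2 * h), t ∈ Ioo (-τ) τ := fun t ht =>
    ⟨by linarith [ht.1], by linarith [ht.2]⟩
  have hKNt : ∀ t ∈ Icc (0 : ℝ) (0 + 2 * h), Real.exp (K * N * t) ≤ E := by
    intro t ht
    rw [hE]; refine Real.exp_le_exp.2 ?_
    have : K * N * t ≤ K * N * (2 * h) := mul_le_mul_of_nonneg_left (by linarith [ht.2]) (by positivity)
    have e2 : K * N * (2 * h) = 2 * K * (h * N) := by ring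
    rw [e2, hhN] at this; exact this
  -- oscillation bounds in the form of the step lemma
  have hmF : ∀ t ∈ Icc (0 : ℝ) (0 + 2 * h), F2 N 0 / E ≤ F2 N t := by
    intro t ht
    have ht' : t ∈ Ico 0 τ := ⟨ht.1, by linarith [ht.2]⟩
    have h2 := (hosc N t ht').2
    have hEt := hKNt t ht
    have hEpos : 0 < Real.exp (K * N * t) := Real.exp_pos _
    rw [div_le_iff₀ hE0]
    have hF2t : 0 ≤ F2 N t := by
      by_contra hneg
      have : Real.exp (K * N * t) * F2 N t < 0 := mul_neg_of_pos_of_neg hEpos (not_le.1 hneg)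
      linarith [hF2 N]
    calc F2 N 0 ≤ Real.exp (K * N * t) * F2 N t := h2
      _ ≤ E * F2 N t := mul_le_mul_of_nonneg_right hEt hF2t
      _ = F2 N t * E := mul_comm _ _
  have hMF : ∀ t ∈ Icc (0 : ℝ) (0 + 2 * h), F2 N t ≤ E * F2 N 0 := by
    intro t ht
    have ht' : t ∈ Ico 0 τ := ⟨ht.1, by linarith [ht.2]⟩
    exact ((hosc N t ht').1).trans (mul_le_mul_of_nonneg_right (hKNt t ht) (hF2 N))
  have hmφ : ∀ t ∈ Icc (0 : ℝ) (0 + 2 * h), φ2 0 - e / 16 ≤ φ2 t := by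
    intro t ht
    have : |φ2 t - φ2 0| < e / 16 := hδ (by rw [Real.dist_eq, sub_zero, abs_of_nonneg ht.1]; linarith [ht.2])
    linarith [(abs_lt.1 this).1]
  have hMφ : ∀ t ∈ Icc (0 : ℝ) (0 + 2 * h), φ2 t ≤ φ2 0 + e / 16 := by
    intro t ht
    have : |φ2 t - φ2 0| < e / 16 := hδ (by rw [Real.dist_eq, sub_zero, abs_of_nonneg ht.1]; linarith [ht.2])
    linarith [(abs_lt.1 this).2]
  have hr0 := hr N 0 ⟨by linarith, hτ⟩
  have hr1 := hr N h ⟨by linarith, by linarith⟩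
  have hr2 := hr N (2 * h) ⟨by linarith, by linarith⟩
  have step := deriv2_div_mem_of_step (ω := e / 16) hh0 hNpos hE1
    (fun t ht => hF N t (hIcc t ht)) (fun t ht => hF1 N t (hIcc t ht)) hmF hMF
    (fun t ht => hφ t (hIcc t ht)) (fun t ht => hφ1 t (hIcc t ht)) hmφ hMφ
    (fun t ht => hG t (hIcc t ht)) (fun t ht => hG1 t (hIcc t ht)) (fun t ht => hB t (hIcc t ht)) hr0 hr1 hr2
  rw [hh2N] at step
  have hq : 4 * ε N / (η ^ 2 / N) = 4 * (N * ε N) / η ^ 2 := by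
    field_simp
  rw [hq] at step
  obtain ⟨hlow, hup⟩ := step
  -- conclude
  set X := e / 16 + B / N + 4 * (N * ε N) / η ^ 2 with hX
  have hX0 : 0 ≤ X := by
    have hε0 : 0 ≤ ε N := le_trans (abs_nonneg _) hr0
    have : 0 ≤ 4 * (N * ε N) / η ^ 2 := by positivity
    rw [hX]; positivity
  have hXe : X ≤ e / 8 := by rw [hX]; linarith only [hN3, hN4]
  have hEm1 : 0 ≤ E - 1 := by linarith only [hE1]
  have habs := le_abs_self (φ2 0)
  have h4 : (E - 1) * |φ2 0| ≤ 4 * K * η * A := by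
    have a1 : (E - 1) * |φ2 0| ≤ (4 * K * η) * |φ2 0| :=
      mul_le_mul_of_nonneg_right (by linarith only [hEup]) (abs_nonneg _)
    have a2 : (4 * K * η) * |φ2 0| ≤ (4 * K * η) * A := mul_le_mul_of_nonneg_left hφA (by positivity)
    linarith only [a1, a2]
  have hup' : F2 N 0 / N ≤ E * (φ2 0 + X) := by rw [hX]; linarith only [hup]
  have hlow' : (φ2 0 - X) / E ≤ F2 N 0 / N := by rw [hX]; refine le_trans (le_of_eq ?_) hlow; ring
  rw [Real.dist_eq, abs_sub_lt_iff]
  constructor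
  · have h3 : (E - 1) * φ2 0 ≤ (E - 1) * |φ2 0| := mul_le_mul_of_nonneg_left habs hEm1
    have h5 : E * X ≤ 3 * X := mul_le_mul_of_nonneg_right hE3 hX0
    have h6 : E * (φ2 0 + X) = φ2 0 + (E - 1) * φ2 0 + E * X := by ring
    linarith only [hup', h3, h4, h5, h6, hKηA, hXe, he]
  · have h7 : E * (φ2 0 - (E - 1) * |φ2 0| - X) ≤ φ2 0 - X := by
      have b1 : (E - 1) * φ2 0 ≤ (E - 1) * |φ2 0| := mul_le_mul_of_nonneg_left habs hEm1
      have b2 : (E - 1) * |φ2 0| ≤ E * ((E - 1) * |φ2 0|) := by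
        have := mul_le_mul_of_nonneg_right hE1 (mul_nonneg hEm1 (abs_nonneg (φ2 0)))
        linarith only [this]
      have b3 : X ≤ E * X := by have := mul_le_mul_of_nonneg_right hE1 hX0; linarith only [this]
      have b4 : E * (φ2 0 - (E - 1) * |φ2 0| - X) = E * φ2 0 - E * ((E - 1) * |φ2 0|) - E * X := by ring
      have b5 : E * φ2 0 = φ2 0 + (E - 1) * φ2 0 := by ring
      linarith only [b1, b2, b3, b4, b5]
    have h8 : φ2 0 - (E - 1) * |φ2 0| - X ≤ (φ2 0 - X) / E := by
      rw [le_div_iff₀ hE0]; linarith only [h7]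
    linarith only [hlow', h8, h4, hKηA, hXe, he]

end Literature.Analysis
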